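import Summits.QuantumFields.YangMills.Theorems.UnitScaleTiltProp7SectET3Eq3124RowsT3
import Summits.QuantumFields.YangMills.Theorems.UnitScaleTiltProp7SectET3DeltaPiT3PInv
import HarnessLib

/-!
# Route `UnitScaleTilt`, crux K1 «MinimiserStabilityRegPr» (stmt-QuantumFields-19200), EX row `norm_G` — NORM_G ROAD brick N6, FILE B (★px19 g14 LOCATE-N6 fa94c431 §4 item 2):
# **(G-iii) `G(D(R_S g)) = Dλ − G(Δx(Dλ))`, `λ := G′ᴾ(R_S g) ∈ N_S`, `Δ₀λ = R_S g`, FOR EVERY SLOT `Δx`** — the Green operator of `Δ_a(Δx) = Δx + DR_SD* + Q_k†aQ_k` on the PURE-GAUGE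
# component `D(R_S L^∞)` of the source space `𝒴` of the N6 Neumann knit ([Balaban1985BackgroundPropagators] (3.118)–(3.124); at a slot killing `D N_S` the defect `G(Δx(Dλ))` is `0` and
# (G-iii) is ✓`Prop7SectET3CurvedPropagators.GT_DL2_RS`)

Cell `ym3-torus` (HUMAN RULING D-0037; rung R3 = SU(2) YM₃ on T³ — NOT d = 4, NOT infinite volume, NOT a mass gap, NOT Clay).  Fleet lead ∕ chair seat `ym-ust-19200-p1` (gen 27),
CHAIR WORD №28 «items 1–4 → ★p1».  THEOREMS ONLY (0 `def`, 0 `sorry`); `--supports stmt-QuantumFields-19200 --as helper`; count-neutral.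

WHY.  In the `(sup, sup∘D*)` currency of LOCATE-N6 §2(ii) the perturbation `Δ′u = −Δ^η(Dλ₁) − D(R_S g₂)` has a pure-gauge word `D(R_S g₂)`; the Green operator `G₀` of the RAW slot
`Δ^η` does NOT kill `D N_S` (only `Δ_πᴾ`, `Δ₁ᴾ` do), so ✓`GT_DL2_RS` (hypothesis `hΔ : Δx kills D N_S`) does not apply verbatim.  Its slot-free form is one line of algebra:
`Δ_a(Dλ) = Δx(Dλ) + D(R_SΔ₀λ) + Q_k†aQ_k(Dλ) = Δx(Dλ) + D(Δ₀λ)` for `λ ∈ N_S` ((3.115) `Q_kDλ = 0`, (3.21) `R_S` fixes `Δ₀N_S`), hence `G(D(Δ₀λ)) = Dλ − G(Δx(Dλ))`; and every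
`R_S g` IS such a `Δ₀λ` with the CANONICAL representative `λ := G′ᴾ(R_S g)` (the Moore–Penrose potential: `∈ N_S`, `Δ₀λ = R_S g` — so the (c)-letters `‖G′ᴾR_S‖`, `‖DG′ᴾR_S‖` of the knit
bound `λ` and `Dλ` by name).

WHAT IS PROVED (ns `…Theorems.Prop7GreenOnPureGaugeSources`; member `F n K`, `h : n ≤ K`, weights `c₀ cB > 0`, coupling `a`, Moore–Penrose coupling `0 ≤ a′`).
* §1 the canonical potential: `kerDProj_mem_NS` (`P₀x ∈ N_S`), ★ `GprimeP_RS_eq_sub` (`G′ᴾ_{a′}(R_S g) = λ₀ − P₀λ₀` for the `N_S`-preimage `λ₀` of ✓`exists_mem_NS_RS_eq`),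
  ★★ `GprimeP_RS_mem_NS` (`G′ᴾ_{a′}(R_S g) ∈ N_S`), ★★ `covLapSite_GprimeP_RS` (`Δ₀(G′ᴾ_{a′}(R_S g)) = R_S g`), `DL2_GprimeP_RS_eq_DL2` (`D(G′ᴾ(R_S g)) = Dλ₀`).
* §2 any slot: ★★ `laplaceA_DL2_of_mem_NS'` (`Δ_a(Δx)(Dλ) = Δx(Dλ) + D(Δ₀λ)` for `λ ∈ N_S`), ★★★ `GT_DL2_covLapSite_of_mem_NS` (`G(D(Δ₀λ)) = Dλ − G(Δx(Dλ))` on `PosOnto`),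
  ★★★ **`GT_DL2_RS_eq`** — (G-iii): `G(D(R_S g)) = D(G′ᴾ_{a′}(R_S g)) − G(Δx(D(G′ᴾ_{a′}(R_S g))))` on `PosOnto`, EVERY slot `Δx`, every `g`.
* §3 the two slots of the knit: ★★ `GT_DeltaEtaSlot_DL2_RS_eq` (`Δx := DeltaEtaSlot`: defect `G₀(Δ^η(Dλ))`, an `O(α)` source by FILE A's (C-val)) and
  ★★ `GT_DeltaEtaSlot_add_DL2_RS_eq` (`Δx := DeltaEtaSlot + T`: defect `G(Δ^η(Dλ) + T(Dλ))`).
HONEST SCOPE.  Linear algebra over landed letters; no estimate; nothing of `norm_G`, the 8 EX print rows, `hThm2S`, EX `stub_existenceMinimalOrbit` or the crux is proved; nothing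
continuum ∕ OS ∕ mass-gap ∕ Clay.

References: T. Bałaban, CMP **99** (1985) 389–434 [Balaban1985BackgroundPropagators] ((3.21)–(3.27) pp.394–395, (3.115) p.418, (3.118)–(3.124) pp.419–420, (3.130) p.421);
CMP **96** (1984) 223–250 [Balaban1984PropagatorsII] ((2.31) p.227).
-/

set_option autoImplicit false

noncomputable section

open scoped InnerProductSpace ComplexConjugate Matrix.Norms.L2Operator

namespace Summit.QuantumFields.YangMills.Theorems.Prop7GreenOnPureGaugeSources

open Literature.MathematicalPhysics.QuantumFieldTheory.Balaban1983to89
open Literature.MathematicalPhysics.QuantumFieldTheory.Balaban1983to89.T3ContinuumYM3Torus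
open B9Eq311L2Pairing (WL2)
open B11Eq103H1Complex (SiteL2K BondL2K)
open Summit.QuantumFields.YangMills.Theorems.Prop7SectET3Transport (periodsT3)
open Summit.QuantumFields.YangMills.Theorems.Prop7SectET3HilbertLetters (W₂ QL2 DL2 DstarL2 covLapSite)
open Summit.QuantumFields.YangMills.Theorems.Prop7SectET3GaugeProjector (NS RS QL2_DL2_eq_zero_of_mem_NS mem_NS_of_DL2_eq_zero RS_apply_covLapSite_of_mem exists_mem_NS_RS_eq)
open Summit.QuantumFields.YangMills.Theorems.Prop7SectET3WilsonHessian (DeltaEta DeltaEtaSlot DeltaEtaSlot_apply)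
open Summit.QuantumFields.YangMills.Theorems.Prop7SectET3CurvedPropagators (Qk laplaceA PosOnto GT laplaceA_apply GT_laplaceA)
open Summit.QuantumFields.YangMills.Theorems.Prop7SectET3DeltaPi (laplacePrimeA laplacePrimeA_apply_of_mem_NS)
open Summit.QuantumFields.YangMills.Theorems.Prop7SectET3DeltaPiPInv (kerDProj GprimeP GprimeP_laplacePrimeA DL2_kerDProj)

variable {F : T3Family} {n K : ℕ} {h : n ≤ K} {c₀ cB a : ℝ} [Fact (0 < c₀)] [Fact (0 < cB)]

/-! ## §1 The canonical `N_S`-potential `λ := G′ᴾ(R_S g)` of a projected source -/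

omit [Fact (0 < cB)] in
/-- `P₀x ∈ N_S(U₀)`: the projection onto `ker D_{U₀}` lands in the residual gauge algebra (`D(P₀x) = 0`, ✓`mem_NS_of_DL2_eq_zero`). [cite: Balaban1985BackgroundPropagators, (3.21) p.394] -/
theorem kerDProj_mem_NS (U₀ : GaugeField (F.P K) 0 (Matrix.specialUnitaryGroup (Fin 2) ℂ)) (x : SiteL2K ℂ 3 (periodsT3 F K) c₀ W₂) :
    kerDProj F n K c₀ U₀ x ∈ NS F n K h c₀ cB U₀ :=
  mem_NS_of_DL2_eq_zero U₀ (DL2_kerDProj U₀ x)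

/-- ★ **THE MOORE–PENROSE POTENTIAL OF A PROJECTED SOURCE**: if `R_S g = Δ₀λ₀` with `λ₀ ∈ N_S` (✓`exists_mem_NS_RS_eq`), then `G′ᴾ_{a′}(R_S g) = λ₀ − P₀λ₀` for every `0 ≤ a′`
(`Δ′_{a′}λ₀ = Δ₀λ₀` on `N_S`, ✓`laplacePrimeA_apply_of_mem_NS`; `G′ᴾΔ′λ = λ − P₀λ`, ✓`GprimeP_laplacePrimeA`). [cite: Balaban1985BackgroundPropagators, (3.22)–(3.25) p.394] -/
theorem GprimeP_RS_eq_sub {a' : ℝ} (ha' : 0 ≤ a') (U₀ : GaugeField (F.P K) 0 (Matrix.specialUnitaryGroup (Fin 2) ℂ)) {g l₀ : SiteL2K ℂ 3 (periodsT3 F K) c₀ W₂}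
    (hl₀ : l₀ ∈ NS F n K h c₀ cB U₀) (hg : RS F n K h c₀ cB U₀ g = covLapSite F n K c₀ U₀ l₀) :
    GprimeP F n K h c₀ cB a' U₀ (RS F n K h c₀ cB U₀ g) = l₀ - kerDProj F n K c₀ U₀ l₀ := by
  rw [hg, ← laplacePrimeA_apply_of_mem_NS (a := a') U₀ hl₀, GprimeP_laplacePrimeA ha']

/-- ★★ **`G′ᴾ_{a′}(R_S g) ∈ N_S(U₀)`** for every `g` and `0 ≤ a′`. [cite: Balaban1985BackgroundPropagators, (3.21)–(3.25) p.394] -/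
theorem GprimeP_RS_mem_NS {a' : ℝ} (ha' : 0 ≤ a') (U₀ : GaugeField (F.P K) 0 (Matrix.specialUnitaryGroup (Fin 2) ℂ)) (g : SiteL2K ℂ 3 (periodsT3 F K) c₀ W₂) :
    GprimeP F n K h c₀ cB a' U₀ (RS F n K h c₀ cB U₀ g) ∈ NS F n K h c₀ cB U₀ := by
  obtain ⟨l₀, hl₀, hg⟩ := exists_mem_NS_RS_eq (h := h) (cB := cB) U₀ g
  rw [GprimeP_RS_eq_sub ha' U₀ hl₀ hg]
  exact Submodule.sub_mem _ hl₀ (kerDProj_mem_NS U₀ l₀)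

/-- ★★ **`Δ₀(G′ᴾ_{a′}(R_S g)) = R_S g`** — the Moore–Penrose potential solves the covariant Poisson equation with the projected source (`Δ₀P₀ = 0`).
[cite: Balaban1985BackgroundPropagators, (3.22)–(3.25) p.394] -/
theorem covLapSite_GprimeP_RS {a' : ℝ} (ha' : 0 ≤ a') (U₀ : GaugeField (F.P K) 0 (Matrix.specialUnitaryGroup (Fin 2) ℂ)) (g : SiteL2K ℂ 3 (periodsT3 F K) c₀ W₂) :
    covLapSite F n K c₀ U₀ (GprimeP F n K h c₀ cB a' U₀ (RS F n K h c₀ cB U₀ g)) = RS F n K h c₀ cB U₀ g := by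
  obtain ⟨l₀, hl₀, hg⟩ := exists_mem_NS_RS_eq (h := h) (cB := cB) U₀ g
  rw [GprimeP_RS_eq_sub ha' U₀ hl₀ hg, map_sub, hg, sub_eq_self]
  show DstarL2 F n K c₀ U₀ (DL2 F n K c₀ U₀ (kerDProj F n K c₀ U₀ l₀)) = 0
  rw [DL2_kerDProj, map_zero]

/-- `D(G′ᴾ_{a′}(R_S g)) = Dλ₀` for the `N_S`-preimage `λ₀` (`DP₀ = 0`). [cite: Balaban1985BackgroundPropagators, (3.118) p.419] -/
theorem DL2_GprimeP_RS_eq_DL2 {a' : ℝ} (ha' : 0 ≤ a') (U₀ : GaugeField (F.P K) 0 (Matrix.specialUnitaryGroup (Fin 2) ℂ)) {g l₀ : SiteL2K ℂ 3 (periodsT3 F K) c₀ W₂}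
    (hl₀ : l₀ ∈ NS F n K h c₀ cB U₀) (hg : RS F n K h c₀ cB U₀ g = covLapSite F n K c₀ U₀ l₀) :
    DL2 F n K c₀ U₀ (GprimeP F n K h c₀ cB a' U₀ (RS F n K h c₀ cB U₀ g)) = DL2 F n K c₀ U₀ l₀ := by
  rw [GprimeP_RS_eq_sub ha' U₀ hl₀ hg, map_sub, DL2_kerDProj, sub_zero]

/-! ## §2 The Green operator of ANY slot on the pure-gauge sources `D(Δ₀ N_S) = D(R_S ·)` -/

section AnySlot

variable (Δx : GaugeField (F.P K) 0 (Matrix.specialUnitaryGroup (Fin 2) ℂ) → (BondL2K ℂ 3 (periodsT3 F K) c₀ W₂ →ₗ[ℂ] BondL2K ℂ 3 (periodsT3 F K) c₀ W₂))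

/-- ★★ **`Δ_a(Δx)(Dλ) = Δx(Dλ) + D(Δ₀λ)` FOR `λ ∈ N_S`, ANY SLOT** (the slot-free form of ✓`laplaceA_DL2_of_mem_NS`: `Q_kDλ = 0` by (3.115), `D R_S D*Dλ = D R_S Δ₀λ = DΔ₀λ` by (3.21)).
[cite: Balaban1985BackgroundPropagators, (3.115) p.418, (3.21) p.394, (3.26) p.395] -/
theorem laplaceA_DL2_of_mem_NS' (U₀ : GaugeField (F.P K) 0 (Matrix.specialUnitaryGroup (Fin 2) ℂ)) {l : SiteL2K ℂ 3 (periodsT3 F K) c₀ W₂} (hl : l ∈ NS F n K h c₀ cB U₀) :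
    laplaceA F n K h c₀ cB a Δx U₀ (DL2 F n K c₀ U₀ l) = Δx U₀ (DL2 F n K c₀ U₀ l) + DL2 F n K c₀ U₀ (covLapSite F n K c₀ U₀ l) := by
  have hQ : Qk F n K h c₀ cB U₀ (DL2 F n K c₀ U₀ l) = 0 := by
    rw [Qk, LinearMap.smul_apply, QL2_DL2_eq_zero_of_mem_NS U₀ hl, smul_zero]
  rw [laplaceA_apply, hQ, smul_zero, map_zero, add_zero]
  -- `D*Dλ = Δ₀λ` by `rfl`, then `R_S` fixes it
  show Δx U₀ (DL2 F n K c₀ U₀ l) + DL2 F n K c₀ U₀ (RS F n K h c₀ cB U₀ (covLapSite F n K c₀ U₀ l)) = _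
  rw [RS_apply_covLapSite_of_mem U₀ hl]

/-- ★★★ **`G(D(Δ₀λ)) = Dλ − G(Δx(Dλ))` FOR `λ ∈ N_S` ON THE CLASS** — apply `G` to §2's identity (`GΔ_a = 1`, ✓`GT_laplaceA`).
[cite: Balaban1985BackgroundPropagators, (3.27) p.395, (3.124) p.420, (3.130) p.421] -/
theorem GT_DL2_covLapSite_of_mem_NS {U₀ : GaugeField (F.P K) 0 (Matrix.specialUnitaryGroup (Fin 2) ℂ)} (hp : PosOnto F n K h c₀ cB a Δx U₀)
    {l : SiteL2K ℂ 3 (periodsT3 F K) c₀ W₂} (hl : l ∈ NS F n K h c₀ cB U₀) :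
    GT F n K h c₀ cB a Δx U₀ (DL2 F n K c₀ U₀ (covLapSite F n K c₀ U₀ l))
      = DL2 F n K c₀ U₀ l - GT F n K h c₀ cB a Δx U₀ (Δx U₀ (DL2 F n K c₀ U₀ l)) := by
  have e := congrArg (GT F n K h c₀ cB a Δx U₀) (laplaceA_DL2_of_mem_NS' (h := h) (cB := cB) (a := a) Δx U₀ hl)
  rw [GT_laplaceA hp, map_add] at e
  exact eq_sub_of_add_eq' e.symm

/-- ★★★ **(G-iii): `G(D(R_S g)) = D(G′ᴾ_{a′}(R_S g)) − G(Δx(D(G′ᴾ_{a′}(R_S g))))` ON THE CLASS, EVERY SLOT, EVERY `g`, EVERY `0 ≤ a′`** — the Green operator on the pure-gauge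
component of the N6 source space, through the canonical potential `λ := G′ᴾ_{a′}(R_S g) ∈ N_S` (§1).  The defect `G(Δx(Dλ))` vanishes for slots killing `D N_S`
(`Δ_πᴾ`, `Δ₁ᴾ`: ✓`GT_DL2_RS`) and is an `O(α)`-source term for the raw slot `Δ^η` (FILE A's (C-val)). [cite: Balaban1985BackgroundPropagators, (3.118)–(3.124) pp.419–420, (3.130)–(3.131) pp.421–422] -/
theorem GT_DL2_RS_eq {U₀ : GaugeField (F.P K) 0 (Matrix.specialUnitaryGroup (Fin 2) ℂ)} (hp : PosOnto F n K h c₀ cB a Δx U₀) {a' : ℝ} (ha' : 0 ≤ a')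
    (g : SiteL2K ℂ 3 (periodsT3 F K) c₀ W₂) :
    GT F n K h c₀ cB a Δx U₀ (DL2 F n K c₀ U₀ (RS F n K h c₀ cB U₀ g))
      = DL2 F n K c₀ U₀ (GprimeP F n K h c₀ cB a' U₀ (RS F n K h c₀ cB U₀ g))
        - GT F n K h c₀ cB a Δx U₀ (Δx U₀ (DL2 F n K c₀ U₀ (GprimeP F n K h c₀ cB a' U₀ (RS F n K h c₀ cB U₀ g)))) := by
  rw [← GT_DL2_covLapSite_of_mem_NS Δx hp (GprimeP_RS_mem_NS ha' U₀ g), covLapSite_GprimeP_RS ha' U₀ g]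

end AnySlot

/-! ## §3 The two slots of the N6 knit: `Δ^η` (the `G₀` of the series (3.130)) and `Δ^η + T` -/

/-- ★★ **(G-iii) AT THE RAW SLOT `DeltaEtaSlot`**: on `PosOnto … a DeltaEtaSlot U₀`, for every `g` and `0 ≤ a′`,
`G₀(D(R_S g)) = Dλ − G₀(Δ^η(Dλ))`, `λ := G′ᴾ_{a′}(R_S g)` — the defect source `Δ^η(Dλ)` is bounded pointwise by `2α(‖λ(b₋)‖ + ‖λ(b₊)‖)` on `RegPr`
(✓`Prop7CurrentPairingPointwise.norm_symm_DeltaEta_DL2_toL2S_apply_le`). [cite: Balaban1985BackgroundPropagators, (3.130)–(3.131) pp.421–422] -/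
theorem GT_DeltaEtaSlot_DL2_RS_eq {U₀ : GaugeField (F.P K) 0 (Matrix.specialUnitaryGroup (Fin 2) ℂ)} (hp : PosOnto F n K h c₀ cB a (DeltaEtaSlot F n K c₀) U₀)
    {a' : ℝ} (ha' : 0 ≤ a') (g : SiteL2K ℂ 3 (periodsT3 F K) c₀ W₂) :
    GT F n K h c₀ cB a (DeltaEtaSlot F n K c₀) U₀ (DL2 F n K c₀ U₀ (RS F n K h c₀ cB U₀ g))
      = DL2 F n K c₀ U₀ (GprimeP F n K h c₀ cB a' U₀ (RS F n K h c₀ cB U₀ g))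
        - GT F n K h c₀ cB a (DeltaEtaSlot F n K c₀) U₀ (DeltaEta F n K c₀ U₀ (DL2 F n K c₀ U₀ (GprimeP F n K h c₀ cB a' U₀ (RS F n K h c₀ cB U₀ g)))) := by
  rw [GT_DL2_RS_eq (DeltaEtaSlot F n K c₀) hp ha' g, DeltaEtaSlot_apply]

/-- ★★ **(G-iii) AT THE SLOT `DeltaEtaSlot + T`** (the `G_{0J}` of the `G₁`-series (3.138) with `T := TJSlotP`, or any defect `T`): on the class, for every `g` and `0 ≤ a′`,
`G(D(R_S g)) = Dλ − G(Δ^η(Dλ) + T(Dλ))`, `λ := G′ᴾ_{a′}(R_S g)`. [cite: Balaban1985BackgroundPropagators, (3.128) p.421, (3.138) p.423] -/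
theorem GT_DeltaEtaSlot_add_DL2_RS_eq (T : GaugeField (F.P K) 0 (Matrix.specialUnitaryGroup (Fin 2) ℂ) → (BondL2K ℂ 3 (periodsT3 F K) c₀ W₂ →ₗ[ℂ] BondL2K ℂ 3 (periodsT3 F K) c₀ W₂))
    {U₀ : GaugeField (F.P K) 0 (Matrix.specialUnitaryGroup (Fin 2) ℂ)} (hp : PosOnto F n K h c₀ cB a (DeltaEtaSlot F n K c₀ + T) U₀)
    {a' : ℝ} (ha' : 0 ≤ a') (g : SiteL2K ℂ 3 (periodsT3 F K) c₀ W₂) :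
    GT F n K h c₀ cB a (DeltaEtaSlot F n K c₀ + T) U₀ (DL2 F n K c₀ U₀ (RS F n K h c₀ cB U₀ g))
      = DL2 F n K c₀ U₀ (GprimeP F n K h c₀ cB a' U₀ (RS F n K h c₀ cB U₀ g))
        - GT F n K h c₀ cB a (DeltaEtaSlot F n K c₀ + T) U₀
            (DeltaEta F n K c₀ U₀ (DL2 F n K c₀ U₀ (GprimeP F n K h c₀ cB a' U₀ (RS F n K h c₀ cB U₀ g)))
              + T U₀ (DL2 F n K c₀ U₀ (GprimeP F n K h c₀ cB a' U₀ (RS F n K h c₀ cB U₀ g)))) := by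
  rw [GT_DL2_RS_eq (DeltaEtaSlot F n K c₀ + T) hp ha' g, Pi.add_apply, LinearMap.add_apply, DeltaEtaSlot_apply]

end Summit.QuantumFields.YangMills.Theorems.Prop7GreenOnPureGaugeSources

end
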